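/-
Copyright (c) 2026. All rights reserved.
Released under Apache 2.0 license as described in the file LICENSE.
Authors: HodgeCM publication cell (pub-hodgecm2), literature typer `lit-gr91-1` (gen 3).
-/
import Literature.NumberTheory.Weil1964.LocalNormFibreIntegration
import HarnessLib

/-!
# Weil's Hilbert-symbol law for the local Weil index, with the local square theorem discharged

[Weil1964] A. Weil, *Sur certains groupes d'opérateurs unitaires*, Acta Math. 111 (1964), Chap. II n° 28, (28):
for a non-archimedean local field `F` of characteristic `≠ 2`, a non-trivial continuous `ψ`, `a ∉ F²`, `b ≠ 0`:
`γ(b) γ(-ab) = (a, b)_F · γ(1) γ(-a)`.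

`LocalNormFibreIntegration.lean` proves this under two hypotheses valid in every non-archimedean local field:
the local square theorem `hsq : 1 + 𝔭^{k₀} ⊆ F²` and `[Fˣ : N(F(√a)ˣ)] ≤ 2`. Here the first is DISCHARGED for an
abstract `IsNonarchimedeanLocalField F` (Hensel's lemma in the `𝔪`-adically complete valuation ring `𝒪[F]`, Mathlib
`IsAdicComplete 𝓂[F] 𝒪[F]`; O'Meara 63:8: `1 + 4𝔪 ⊆ F²`), and the second is kept in the symmetric form
"the product of two non-norms is a norm" (`[Fˣ : H] ≤ 2`; in the tree for the completions `K_v` of a number field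
as `QuadraticForms.index_quadraticNormSubgroup_adicCompletion_eq_two`).

## References

* [Weil1964] A. Weil, *Sur certains groupes d'opérateurs unitaires*, Acta Math. 111 (1964) 143–211, Chap. II
  n° 28, pp. 175–177.
* [Omeara1963] O. T. O'Meara, *Introduction to quadratic forms*, Springer 1963, §63A (63:1, 63:8).
-/

set_option autoImplicit false

noncomputable section

open MeasureTheory ValuativeRel Filter Topology Set
open scoped NNReal ENNReal Pointwise
open Literature.NumberTheory.GaloisRepresentations.IsNonarchimedeanLocalField
open Literature.NumberTheory.Automorphic

namespace Literature.NumberTheory.Weil1964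

variable {F : Type*} [Field F] [ValuativeRel F] [TopologicalSpace F] [IsNonarchimedeanLocalField F]

/-! ## §1 The local square theorem in an abstract non-archimedean local field -/

section LocalSquares

/-- the valuation ring of a non-archimedean local field is Henselian (it is `𝔪`-adically complete:
Mathlib `IsAdicComplete 𝓂[F] 𝒪[F]` and `IsAdicComplete.henselianRing`). [folklore] -/
private theorem henselianLocalRing_integer' : HenselianLocalRing 𝒪[F] := by
  letI := IsTopologicalAddGroup.rightUniformSpace F
  haveI := isUniformAddGroup_of_addCommGroup (G := F)
  exact
    { is_henselian := fun f hf a₀ h₁ h₂ =>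
        HenselianRing.is_henselian (I := 𝓂[F]) f hf a₀ h₁ (h₂.map _) }

open Polynomial in
/-- **`1 + 4𝔪 ⊆ F²`**: for `‖m‖ < 1`, `1 + 4m` is a square — solve `y² + y = m` in `𝒪` by Hensel's lemma
(`Y² + Y - m` has the simple root `0` modulo `𝔪`) and note `(1 + 2y)² = 1 + 4(y² + y)` (O'Meara 63:8:
`(1 + 𝔭^r)² = 1 + 2𝔭^r` for `𝔭^r ⊆ 2𝔭`). [cite: Omeara1963, §63A Prop. 63:8] -/
theorem isSquare_one_add_four_mul {m : F} (hm : m ∈ primePowBall F 1) : IsSquare (1 + 4 * m) := by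
  haveI : HenselianLocalRing 𝒪[F] := henselianLocalRing_integer'
  have hm1 : valuation F m < 1 := LocalFieldHaar.mem_primePowBall_one_iff.1 hm
  have hm0 : m ∈ 𝒪[F] := LocalFieldHaar.mem_primePowBall_zero_iff.1 (primePowBall_antitone zero_le_one hm)
  set M : 𝒪[F] := ⟨m, hm0⟩ with hM
  have hMm : M ∈ IsLocalRing.maximalIdeal 𝒪[F] := by
    rw [IsLocalRing.mem_maximalIdeal, mem_nonunits_iff]
    exact Valuation.Integer.not_isUnit_iff_valuation_lt_one.2 hm1
  have hmonic : (X ^ 2 + X - C M : (𝒪[F])[X]).Monic := by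
    have : (X ^ 2 + X - C M : (𝒪[F])[X]) = X ^ 2 + (X - C M) := by ring
    rw [this]
    exact (monic_X_pow 2).add_of_left (by
      rw [degree_X_pow]
      exact (degree_sub_le _ _).trans_lt (by
        rw [max_lt_iff]
        exact ⟨by rw [degree_X]; norm_num, degree_C_le.trans_lt (by norm_num)⟩))
  have h0 : (X ^ 2 + X - C M : (𝒪[F])[X]).eval 0 ∈ IsLocalRing.maximalIdeal 𝒪[F] := by
    simp only [eval_sub, eval_add, eval_pow, eval_X, eval_C, ne_eq, OfNat.ofNat_ne_zero,
      not_false_eq_true, zero_pow, add_zero, zero_sub, neg_mem_iff]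
    exact hMm
  have h1 : IsUnit ((derivative (X ^ 2 + X - C M : (𝒪[F])[X])).eval 0) := by
    simp
  obtain ⟨y, hy, -⟩ := HenselianLocalRing.is_henselian _ hmonic 0 h0 h1
  simp only [IsRoot.def, eval_sub, eval_add, eval_pow, eval_X, eval_C] at hy
  have hMc : ((M : 𝒪[F]) : F) = m := rfl
  have hyM : ((y : 𝒪[F]) : F) ^ 2 + (y : F) = m := by
    have h := congrArg (fun z : 𝒪[F] ↦ (z : F)) hy
    push_cast [hMc] at h
    linear_combination h
  refine ⟨1 + 2 * ((y : 𝒪[F]) : F), ?_⟩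
  linear_combination (-4 : F) * hyM

/-- **LOCAL SQUARE THEOREM**: `1 + 𝔭^{2v₂+1} ⊆ F²` where `‖2‖ = q^{-v₂}` (`1 + h = 1 + 4 (h/4)` with
`‖h/4‖ ≤ q⁻¹`). [cite: Omeara1963, §63A Cor. 63:1b] -/
theorem isSquare_one_add_of_mem_primePowBall {v₂ : ℤ} (h2 : normAbs F (2 : F) = (residueFieldCard F : ℝ≥0)⁻¹ ^ v₂)
    (htwo : (2 : F) ≠ 0) {h : F} (hh : h ∈ primePowBall F (2 * v₂ + 1)) : IsSquare (1 + h) := by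
  have h4 : (4 : F) ≠ 0 := by
    rw [show (4 : F) = 2 * 2 by norm_num]; exact mul_ne_zero htwo htwo
  have h4n : normAbs F (4 : F) = (residueFieldCard F : ℝ≥0)⁻¹ ^ (2 * v₂) := by
    rw [show (4 : F) = 2 * 2 by norm_num, map_mul, h2, ← zpow_add₀ inv_residueFieldCard_pos.ne', two_mul]
  have hm : 4⁻¹ * h ∈ primePowBall F 1 := by
    have := (mul_mem_primePowBall_iff h4n (m := 2 * v₂ + 1) (x := 4⁻¹ * h)).1
      (by rwa [mul_inv_cancel_left₀ h4])
    rwa [show 2 * v₂ + 1 - 2 * v₂ = 1 by ring] at this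
  obtain ⟨r, hr⟩ := isSquare_one_add_four_mul hm
  exact ⟨r, by rw [← hr, mul_inv_cancel_left₀ h4]⟩

/-- the hypothesis `hsq` of `LocalNormFibreIntegration` holds: `∃ k₀, 1 + 𝔭^{k₀} ⊆ F²` (`char F ≠ 2`).
[cite: Omeara1963, §63A Cor. 63:1b] -/
theorem exists_forall_isSquare_one_add (htwo : (2 : F) ≠ 0) :
    ∃ k₀ : ℤ, ∀ h ∈ primePowBall F k₀, IsSquare (1 + h) := by
  obtain ⟨v₂, hv₂⟩ := exists_normAbs_eq_inv_zpow htwo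
  exact ⟨2 * v₂ + 1, fun h hh => isSquare_one_add_of_mem_primePowBall hv₂ htwo hh⟩

end LocalSquares

/-! ## §2 The Hilbert-symbol law -/

section HilbertLaw

variable [MeasurableSpace F] [BorelSpace F] (μ : Measure F) [μ.IsAddHaarMeasure] {ψ : AddChar F Circle}

omit [ValuativeRel F] [TopologicalSpace F] [IsNonarchimedeanLocalField F] [MeasurableSpace F] [BorelSpace F] in
/-- from "the product of two non-norms is a norm" (`[Fˣ : H] ≤ 2`) to the form used in
`LocalNormFibreIntegration`: a non-norm `t` is `ε` times a norm. [folklore] -/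
private theorem inv_mul_mem_range_of_index_two {a ε : F}
    (hidx : ∀ s t : F, s ∉ Set.range (normForm a) → t ∉ Set.range (normForm a) → s * t ∈ Set.range (normForm a))
    (hε : ε ∉ Set.range (normForm a)) (t : F) (_ht : t ≠ 0) (htN : t ∉ Set.range (normForm a)) :
    ε⁻¹ * t ∈ Set.range (normForm a) := by
  refine hidx ε⁻¹ t (fun h => hε ?_) htN
  simpa using inv_mem_range_normForm h

/-- **THE SIGN ON THE NON-TRIVIAL NORM CLASS** (hypothesis-free form of
`LocalNormFibreIntegration.weilGauss_mul_weilGauss_nonNorm`): for `a ∉ F²`, `ε ∉ H = N(F(√a)ˣ)`,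
`[Fˣ : H] ≤ 2` and `b ≠ 0`, `g(b) g(-ab) = -‖ε‖ · g(εb) g(-aεb)`. [cite: Weil1964, Chap. II n° 28, Prop. 4, p. 176] -/
theorem weilGauss_mul_weilGauss_of_not_mem_range_normForm (hψ : ψ.IsContinuousNontrivial) {a ε b : F}
    (ha : ¬ IsSquare a) (hb : b ≠ 0) (htwo : (2 : F) ≠ 0) (hε : ε ∉ Set.range (normForm a))
    (hidx : ∀ s t : F, s ∉ Set.range (normForm a) → t ∉ Set.range (normForm a) → s * t ∈ Set.range (normForm a)) :
    weilGauss ψ μ b * weilGauss ψ μ (-(a * b)) =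
      -(((normAbs F ε : ℝ) : ℂ) * (weilGauss ψ μ (ε * b) * weilGauss ψ μ (-(a * (ε * b))))) := by
  obtain ⟨k₀, hsq⟩ := exists_forall_isSquare_one_add (F := F) htwo
  exact weilGauss_mul_weilGauss_nonNorm μ hψ ha hb htwo hsq hε (inv_mul_mem_range_of_index_two hidx hε)

/-- **`γ(εb) γ(-aεb) = -γ(b) γ(-ab)`** for `ε ∉ H`, `[Fˣ : H] ≤ 2`. [cite: Weil1964, Chap. II n° 28, Prop. 4, p. 176] -/
theorem weilIndex_mul_weilIndex_of_not_mem_range_normForm (hψ : ψ.IsContinuousNontrivial) {a ε b : F}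
    (ha : ¬ IsSquare a) (hb : b ≠ 0) (htwo : (2 : F) ≠ 0) (hε : ε ∉ Set.range (normForm a))
    (hidx : ∀ s t : F, s ∉ Set.range (normForm a) → t ∉ Set.range (normForm a) → s * t ∈ Set.range (normForm a)) :
    weilIndex ψ μ (ε * b) * weilIndex ψ μ (-(a * (ε * b))) = -(weilIndex ψ μ b * weilIndex ψ μ (-(a * b))) := by
  obtain ⟨k₀, hsq⟩ := exists_forall_isSquare_one_add (F := F) htwo
  exact weilIndex_mul_weilIndex_nonNorm μ hψ ha hb htwo hsq hε (inv_mul_mem_range_of_index_two hidx hε)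

/-- **`(a, b)_F = -1 ⟹ γ(b) γ(-ab) = -γ(1) γ(-a)`** (`[Fˣ : H] ≤ 2`).
[cite: Weil1964, Chap. II n° 28, Prop. 4 and (28), pp. 176–177] -/
theorem weilIndex_mul_weilIndex_of_hilbertSymbol_eq_neg_one (hψ : ψ.IsContinuousNontrivial) {a b : F}
    (ha : ¬ IsSquare a) (hb : b ≠ 0) (htwo : (2 : F) ≠ 0)
    (hidx : ∀ s t : F, s ∉ Set.range (normForm a) → t ∉ Set.range (normForm a) → s * t ∈ Set.range (normForm a))
    (h : QuadraticForms.hilbertSymbol F a b = -1) :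
    weilIndex ψ μ b * weilIndex ψ μ (-(a * b)) = -(weilIndex ψ μ 1 * weilIndex ψ μ (-a)) := by
  obtain ⟨k₀, hsq⟩ := exists_forall_isSquare_one_add (F := F) htwo
  exact weilIndex_mul_weilIndex_eq_neg_of_hilbertSymbol_eq_neg_one μ hψ ha hb htwo hsq
    (inv_mul_mem_range_of_index_two hidx (not_mem_range_normForm_of_hilbertSymbol_eq_neg_one ha hb htwo h)) h

/-- **WEIL'S HILBERT-SYMBOL LAW (28), binary form**: for `a ∉ F²`, `b ≠ 0`, `char F ≠ 2` and
`[Fˣ : N(F(√a)ˣ)] ≤ 2`: `γ(b) γ(-ab) = (a, b)_F · γ(1) γ(-a)` — i.e. the Weil index of the norm form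
`x² - ay² - bz² + abt²` of the quaternion algebra `(a, b)_F` is its Hasse invariant. The local square theorem
needed by the fibre integration is discharged here; the index hypothesis is O'Meara 63:13a.
[cite: Weil1964, Chap. II n° 28, (28), p. 176] -/
theorem weilIndex_mul_weilIndex_eq_hilbertSymbol_mul_of_index_two (hψ : ψ.IsContinuousNontrivial) {a b : F}
    (ha : ¬ IsSquare a) (hb : b ≠ 0) (htwo : (2 : F) ≠ 0)
    (hidx : ∀ s t : F, s ∉ Set.range (normForm a) → t ∉ Set.range (normForm a) → s * t ∈ Set.range (normForm a)) :
    weilIndex ψ μ b * weilIndex ψ μ (-(a * b)) =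
      (QuadraticForms.hilbertSymbol F a b : ℂ) * (weilIndex ψ μ 1 * weilIndex ψ μ (-a)) := by
  have ha0 : a ≠ 0 := fun h0 => ha (h0 ▸ IsSquare.zero)
  rcases QuadraticForms.hilbertSymbol_eq_one_or_eq_neg_one a b with h | h
  · rw [h, weilIndex_mul_weilIndex_eq_of_hilbertSymbol_eq_one μ hψ ha0 hb htwo h]; push_cast; ring
  · rw [h, weilIndex_mul_weilIndex_of_hilbertSymbol_eq_neg_one μ hψ ha hb htwo hidx h]; push_cast; ring

end HilbertLaw

end Literature.NumberTheory.Weil1964
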